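import Literature.Probability.Percolation.QuadLowestCrossingProofs
import HarnessLib

/-!
# One-sided continuity of quad crossings on `δℤ²`: moving the left side (Schramm–Smirnov, Lemma 6.1 (2))

Topic `Probability/Percolation`.  O. Schramm, S. Smirnov, *On the scaling limits of planar
percolation*, Ann. Probab. 39 (2011) 1768–1814, arXiv:1101.5820, Lemma 6.1 (2) and its proof,
bound the probability that a quad is crossed while a slightly larger quad — obtained by moving
one of the two distinguished sides outward — is not.  For bond percolation on `δℤ²` at `p = 1/2`
and quads charted by a homeomorphism `H : ℂ ≃ₜ ℂ` of straight rectangles, the move of the RIGHT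
side is `SSContinuity.exists_move_bound` (`QuadLowestCrossingProofs.lean`).  This file proves the
mirror statement for the LEFT side, by reflecting the chart in the imaginary axis
(`negRe : x + iy ↦ -x + iy`):

* `ChartCrossed.negRe_trans`, `chartCrossed_negRe_trans_iff` — **the reflection identity**
  `ChartCrossed (negRe.trans H) a b c d δ ω ↔ ChartCrossed H (-b) (-a) c d δ ω` (a crossing
  continuum `K` of `[a,b] × [c,d]` reflects to the crossing continuum `negRe '' K` of
  `[-b,-a] × [c,d]`, left and right sides exchanged);
* `trans_addRight_zero` — the translate by `0` of a chart is the chart;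
* `exists_leftMove_bound` — **Lemma 6.1 (2), left side**: for every chart `H` and `ε > 0` there is
  `Δ₀ > 0`, and for every `0 < Δ ≤ Δ₀` a `δ₀ > 0`, such that for all meshes `0 < δ < δ₀` and all
  rectangles `[a,b] × [c,d]` with `-2 ≤ a - Δ`, `1 ≤ b - a`, `b ≤ 2`, `-2 + 1/8 ≤ c`, `1 ≤ d - c`,
  `d ≤ 2`: `P_{1/2}(H([a,b] × [c,d]) crossed and H([a-Δ,b] × [c,d]) not crossed) ≤ ε` — the
  right-side move `exists_move_bound` for the reflected chart `H ∘ negRe` (translate `v = 0`) and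
  the reflected rectangle `[-b,-a] × [c,d]`.

Everything here is proved; no named fact is introduced.

## References

* O. Schramm, S. Smirnov, Ann. Probab. 39 (2011) 1768–1814, arXiv:1101.5820, Lemma 6.1 (2) and
  its proof. [SchrammSmirnov2011]
-/

noncomputable section

open Set Metric Complex
open _root_.MeasureTheory _root_.Topology
open scoped ENNReal
open Literature.Probability.LatticeModels

namespace Literature.Probability.Percolation

namespace SSContinuity

/-! ### The reflection identity -/

/-- **Reflecting a chart crossing in the imaginary axis of the chart**: a crossing continuum `K`
of `[a,b] × [c,d]` drawn through `G` gives the crossing continuum `negRe '' K` of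
`[-b,-a] × [c,d]` drawn through `G ∘ negRe` (the two vertical sides are exchanged). [folklore] -/
theorem ChartCrossed.negRe_trans {G : ℂ ≃ₜ ℂ} {a b c d δ : ℝ} {ω : BondConfig (Site 2)}
    (h : ChartCrossed G a b c d δ ω) : ChartCrossed (negRe.trans G) (-b) (-a) c d δ ω := by
  obtain ⟨K, hKsub, hKc, hKconn, hKopen, ⟨u, huK, hua⟩, ⟨w, hwK, hwb⟩⟩ := h
  refine ⟨negRe '' K, ?_, hKc.image negRe.continuous,
    hKconn.image negRe negRe.continuous.continuousOn, ?_,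
    ⟨negRe w, mem_image_of_mem _ hwK, by rw [negRe_re, hwb]⟩,
    ⟨negRe u, mem_image_of_mem _ huK, by rw [negRe_re, hua]⟩⟩
  · rintro _ ⟨z, hz, rfl⟩
    have hz' := hKsub hz
    rw [mem_reProdIm] at hz' ⊢
    refine ⟨⟨?_, ?_⟩, ?_⟩
    · rw [negRe_re]; exact neg_le_neg hz'.1.2
    · rw [negRe_re]; exact neg_le_neg hz'.1.1
    · rw [negRe_im]; exact hz'.2
  · rintro _ ⟨z, hz, rfl⟩
    rw [Homeomorph.trans_apply, negRe_negRe]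
    exact hKopen z hz

/-- `negRe` is an involution at the level of charts: `(G ∘ negRe) ∘ negRe = G`. [folklore] -/
theorem negRe_trans_negRe_trans (G : ℂ ≃ₜ ℂ) : negRe.trans (negRe.trans G) = G :=
  Homeomorph.ext fun u => by rw [Homeomorph.trans_apply, Homeomorph.trans_apply, negRe_negRe]

/-- **The reflection identity**: the rectangle `[a,b] × [c,d]` is crossed through the reflected
chart `H ∘ negRe` iff the reflected rectangle `[-b,-a] × [c,d]` is crossed through `H`.
[folklore] -/
theorem chartCrossed_negRe_trans_iff (H : ℂ ≃ₜ ℂ) (a b c d δ : ℝ) (ω : BondConfig (Site 2)) :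
    ChartCrossed (negRe.trans H) a b c d δ ω ↔ ChartCrossed H (-b) (-a) c d δ ω := by
  constructor
  · intro h
    have h' := h.negRe_trans
    rwa [negRe_trans_negRe_trans] at h'
  · intro h
    have h' := h.negRe_trans
    rwa [neg_neg, neg_neg] at h'

/-- The translate of a chart by `0` is the chart. [folklore] -/
theorem trans_addRight_zero (G : ℂ ≃ₜ ℂ) : G.trans (Homeomorph.addRight (0 : ℂ)) = G :=
  Homeomorph.ext fun u => by simp

/-! ### The estimate -/

/-- **Schramm–Smirnov's Lemma 6.1, case (2), for charted rectangles on bond-`ℤ²`, moving the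
LEFT side — with constants.**  For every chart `H : ℂ ≃ₜ ℂ` and `ε > 0` there is `Δ₀ > 0`, and
for every `0 < Δ ≤ Δ₀` a `δ₀ > 0`, such that for all meshes `0 < δ < δ₀` and all rectangles
`[a,b] × [c,d]` with `-2 ≤ a - Δ`, `1 ≤ b - a`, `b ≤ 2`, `-2 + 1/8 ≤ c`, `1 ≤ d - c`, `d ≤ 2`:
`P_{1/2}(H([a,b] × [c,d]) crossed and H([a-Δ,b] × [c,d]) not crossed) ≤ ε`.
(The right-side move `exists_move_bound` for the reflected chart `H ∘ negRe`, translate `v = 0`,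
and the reflected rectangle `[-b,-a] × [c,d]`, via `chartCrossed_negRe_trans_iff`.)
[cite: SchrammSmirnov2011, Lemma 6.1 (2)] -/
theorem exists_leftMove_bound (H : ℂ ≃ₜ ℂ) {ε : ℝ} (hε : 0 < ε) :
    ∃ Δ₀ : ℝ, 0 < Δ₀ ∧ ∀ Δ : ℝ, 0 < Δ → Δ ≤ Δ₀ → ∃ δ₀ : ℝ, 0 < δ₀ ∧ ∀ δ : ℝ, 0 < δ → δ < δ₀ →
      ∀ a b c d : ℝ, -2 ≤ a - Δ → 1 ≤ b - a → b ≤ 2 → -2 + 1 / 8 ≤ c → 1 ≤ d - c → d ≤ 2 →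
        bondPercolation (zdGraph 2) half
          {ω | ChartCrossed H a b c d δ ω ∧ ¬ ChartCrossed H (a - Δ) b c d δ ω} ≤
          ENNReal.ofReal ε := by
  obtain ⟨Δ₀, hΔ₀, hmove⟩ := exists_move_bound (negRe.trans H) hε
  refine ⟨Δ₀, hΔ₀, fun Δ hΔ hΔΔ₀ => ?_⟩
  obtain ⟨δ₀, hδ₀, hmove'⟩ := hmove Δ hΔ hΔΔ₀
  refine ⟨δ₀, hδ₀, fun δ hδ hδδ₀ a b c d ha hab hb hc hcd hd => ?_⟩
  have h := hmove' δ hδ hδδ₀ 0 (by simp) (-b) (-a) c d (by linarith) (by linarith) (by linarith)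
    hc hcd hd
  rw [trans_addRight_zero] at h
  have hset : {ω | ChartCrossed H a b c d δ ω ∧ ¬ ChartCrossed H (a - Δ) b c d δ ω} =
      {ω | ChartCrossed (negRe.trans H) (-b) (-a) c d δ ω ∧
        ¬ ChartCrossed (negRe.trans H) (-b) (-a + Δ) c d δ ω} := by
    ext ω
    rw [mem_setOf_eq, mem_setOf_eq, chartCrossed_negRe_trans_iff, chartCrossed_negRe_trans_iff,
      neg_neg, neg_neg, show -(-a + Δ) = a - Δ by ring]
  rw [hset]
  exact h

end SSContinuity

end Literature.Probability.Percolation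

end
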